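import Summits.HodgeConjecture.HodgeConjecture.Theorems.F0P3cStCharTSSocketsOut   -- ★ (LH6-p02 g4) p850909 «SOCKETS-OUT★»: `isEllipticRep_of_isEllipticPair`; brings ★ «SC-FIN» p848548 (`innerG_conj_symm`), ★ TR carpets `Ch12Sec5Inputs` ((C2) `EllCartanAE`), `Ch12Sec6` (`PseudoCoeffExists`, `PseudoCoeffTrace`, `Prop1261b∕c`), ★ `Gqs`
import Summits.HodgeConjecture.HodgeConjecture.Theorems.F0P3cStCharTSPsePseudo     -- ★ (LH6-p01 g2) p849428 «PSE★», ED. 2 (LH6-p02 g4): `psTrace_pseudoCoeff_eq_zero_of_isPseudoCoeff` (principal-series traces vanish against pseudo-coefficients; COMPAT + (SPLIT-NOT-ELL))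
import HarnessLib

/-!
# F0 · P3c · line LH6 «StCharTS» — brick «MATE-UNIQ-OUT★» for the (S-𝔇) package `stub_EllipticPackage`:
# THE SOCKET (MATE-UNIQ) «a square-integrable `σ` has at most ONE non-square-integrable elliptic partner» DERIVED FROM THE PACKAGE'S OTHER CONJUNCTS

Cell `hodgecm-mathlib`, crux `H413` (`stmt-HodgeConjecture-24833`), line LH6 `Cruxes/H413/Lines/F0_P3c_StCharTSPaydown.lean` (organ (S-𝔇) `stub_EllipticPackage`: an
existential over a §12.5 datum `𝔇 : Ch12Sec5.EllipticData (U(Φ₃)(L⁺_v)) (H_v)`, 54 conjuncts at ED. 13∕14).  Seat LH6-p02 (g4); THEOREMS ONLY (no `def`, no named fact, no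
`instance`, no notation, no `sorry`; axioms ⊆ {propext, Classical.choice, Quot.sound}); `--supports stmt-HodgeConjecture-24833 --as helper`.  Sequel to ★ «SOCKETS-OUT★»
(p850909) and ★ «LDSU-OUT★» (LH6-p04 (g5), p851084).
HONEST LABEL: HC_CM is proved only modulo the 7 printed citations (2 remaining: hLiu418 = stmt-HodgeConjecture-24832, h413 = stmt-HodgeConjecture-24833) until rung 0
closes; this file is count-neutral — it lets a later leaf edition DELETE the socket (MATE-UNIQ) (ED. 14 text
`∀ σ u u' : IrrClass (Gqs L v), 𝔇.IsL2 σ → ¬ 𝔇.IsL2 u → ¬ 𝔇.IsL2 u' → 𝔇.IsEllipticPair u σ → 𝔇.IsEllipticPair u' σ → u = u'`, consumed only by the (S-a) call's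
binder `hMU` → ★ `F0P3cStCharTSSaRegroupKinds.exists_kinds`), feeding that binder BY NAME from conjuncts the package keeps.

THE MATHEMATICS — print's own argument ([Rogawski1990, §12.2 pp. 173–174: `JH(i_G(χ)) = {π²(ξ), πⁿ(ξ)}` resp. `{St_G(ψ), ψ∘det}`, so `χ_u + χ_σ` is the character
of the principal series `i_G(χ)`; §12.6 p. 187 «`Φ(γ, f_π) = 0` if `γ ∈ G^r − G^e`»; Lemma 12.7.2 (proof) p. 192 «`Tr(i_G(θ̃))(f) = 0`» for a pseudo-coefficient `f`]).
Let `σ` be square-integrable and `u, u′` non-square-integrable with `{u, σ}`, `{u′, σ}` both pairs of the three kinds (★ `IsEllipticPair`).  `u ≠ σ ≠ u′` (square-integrability),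
so Prop. 12.6.1 (c) [p. 188] (★ `Prop1261c`, typed for every pair of distinct classes of one of the three kinds) gives `⟨χ_{u′}, χ_σ⟩_e = −1`, and `u, u′, σ` are elliptic (★
«SOCKETS-OUT★» `isEllipticRep_of_isEllipticPair`, from (c) + (C2)).  Take a pseudo-coefficient `f = f_{u′}` of `u′` (★ `PseudoCoeffExists`).  The PAIR socket (PS2) of the
package («`Tr u(f) + Tr σ(f) = Tr i_G(par u)(f)` on `C_c^∞`», distributional form of `χ_u + χ_σ = χ_{i_G(χ)}`) and ★ «PSE★» ED. 2 («`Tr i_G(χ)(f) = 0` for a pseudo-coefficient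
`f` of ANY class», from COMPAT `𝔇.orb = mQv`, `regG ↔ IsRegularElt` and (SPLIT-NOT-ELL); continuity of `par u` from (NONL2-PAR)) give `Tr u(f) = −Tr σ(f)`; «`Tr π′(f_π) =
⟨χ_{π′}, χ_π⟩_e`» (★ `PseudoCoeffTrace`) turns this into `⟨χ_u, χ_{u′}⟩_e = −⟨χ_σ, χ_{u′}⟩_e = −\overline{⟨χ_{u′}, χ_σ⟩_e} = +1` (★ «SC-FIN» `innerG_conj_symm`).  If `u ≠ u′`,
Prop. 12.6.1 (b) [p. 188] (★ `Prop1261b`: two elliptic classes pairing non-trivially form a pair of the three kinds) and (c) give `⟨χ_u, χ_{u′}⟩_e = −1` — contradiction.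
Hence **(MATE-UNIQ) ⟸ `PseudoCoeffExists` ∧ `PseudoCoeffTrace` ∧ Prop. 12.6.1 (b) ∧ (c) ∧ (C2) ∧ (PS2) ∧ (NONL2-PAR) ∧ COMPAT(`μG`, `orb`, `regG`) ∧ (SPLIT-NOT-ELL)**:
`mateUniq_of_carpet`.  (The sibling census «the inner-product trick is spent on (MATE-UNIQ)» is right — the extra input is the split-torus vanishing ★ «PSE★».)
WHY IT PAYS (datum-construction programme): proving (MATE-UNIQ) at a concrete datum would need the §12.2 LABEL bookkeeping «`St_G(ψ)`, `π²(ξ)` determine `ψ`, `ξ`; the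
Jordan–Hölder pairs are disjoint» ([Ky], [BZ]); this brick trades it for Prop. 12.6.1 (b)(c), (PS2) and (SPLIT-NOT-ELL), which the package owes anyway.

LEAF EFFECT (for the integrator, a later ED. of `Cruxes/H413/Lines/F0_P3c_StCharTSPaydown.lean`): delete the conjunct (MATE-UNIQ), drop `hMU` from the three `obtain`
patterns, and at the (S-a) call feed
`(F0P3cStCharTSMateUniqOut.mateUniq_of_carpet L v hns νQv mQv hcanQ 𝔇 hμG h𝔬 hreg hPCE hPCT h61b h61c hTell hsplit par hPS2 hNP)` in the `hMU` slot (every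
argument an existing binder of the leaf).

## References
* [Rogawski1990] J. D. Rogawski, *Automorphic Representations of Unitary Groups in Three Variables*, Ann. of Math. Stud. 123 (1990): §12.2 pp. 173–174 (the pairs
  `{St_G(ψ), ψ∘det_G}`, `{π²(ξ), πⁿ(ξ)}` = `JH(i_G(χ))`); §12.5 p. 184 (`⟨ , ⟩_{G,e}`, `G^e`); §12.6 p. 187 (pseudo-coefficients, «elliptic representation»), Prop. 12.6.1
  (b)(c) p. 188; §12.7 Lemma 12.7.2 (proof) p. 192 («`Tr(i_G(θ̃))(f) = 0`»; where (MATE-UNIQ) is used: the regrouping (12.7.1) pairs each non-square-integrable member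
  of `X` with ONE square-integrable mate).
-/

set_option autoImplicit false
-- the mandated namespace has the single-problem summit's repeated segment (`HodgeConjecture.HodgeConjecture`)
set_option linter.dupNamespace false

noncomputable section

open NumberField IsDedekindDomain MeasureTheory Filter Topology
open scoped ComplexConjugate
open Literature.NumberTheory.Rogawski1990 Literature.NumberTheory.Automorphic Literature.NumberTheory.Automorphic.UnitaryGroup

namespace Summit.HodgeConjecture.HodgeConjecture.Cruxes.H413.F0P3cStCharTSMateUniqOut

/-! ## §1 Generic: the elliptic-inner-product step (any carriers `G`, `H`) -/

section Generic

variable {G H : Type} [Group G] [TopologicalSpace G] [IsTopologicalGroup G] [MeasurableSpace G]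
  [∀ γ : G, MeasurableSpace (G ⧸ Subgroup.centralizer ({γ} : Set G))] [MeasurableSpace (G ⧸ Subgroup.center G)]
  [Group H] [TopologicalSpace H] [IsTopologicalGroup H] [MeasurableSpace H]
  (𝔇 : Ch12Sec5.EllipticData G H)

/-- **Two mates of `σ` killed together.**  If `u ≠ σ ≠ u′` with `{u, σ}`, `{u′, σ}` pairs of the three kinds, and some pseudo-coefficient `f` of `u′` has
`Tr u(f) + Tr σ(f) = 0` (traces against `𝔇.μG`), then `u = u′`: by ★ `PseudoCoeffTrace` and Prop. 12.6.1 (c) on `{u′, σ}`, `⟨χ_u, χ_{u′}⟩_e = −⟨χ_σ, χ_{u′}⟩_e = +1`, while for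
`u ≠ u′` Prop. 12.6.1 (b)+(c) would give `−1` (all three classes are elliptic by ★ «SOCKETS-OUT★» `isEllipticRep_of_isEllipticPair`).
[cite: Rogawski1990, §12.6 Prop. 12.6.1 (b)(c) p. 188; p. 187] -/
theorem eq_of_mates_of_trace_add_eq_zero
    (hPCT : Ch12Sec6.PseudoCoeffTrace 𝔇) (h61b : Ch12Sec6.Prop1261b 𝔇) (h61c : Ch12Sec6.Prop1261c 𝔇) (hC2 : 𝔇.EllCartanAE)
    {σ u u' : IrrClass G} (huσ : u ≠ σ) (hu'σ : u' ≠ σ)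
    (hpair : 𝔇.IsEllipticPair u σ) (hpair' : 𝔇.IsEllipticPair u' σ)
    {f : G → ℂ} (hf : 𝔇.IsPseudoCoeff u' f)
    (hsum : u.smoothTrace 𝔇.μG f + σ.smoothTrace 𝔇.μG f = 0) :
    u = u' := by
  obtain ⟨hu, -⟩ := F0P3cStCharTSSocketsOut.isEllipticRep_of_isEllipticPair 𝔇 h61c hC2 huσ hpair
  obtain ⟨hu', -⟩ := F0P3cStCharTSSocketsOut.isEllipticRep_of_isEllipticPair 𝔇 h61c hC2 hu'σ hpair'
  -- the two traces are elliptic inner products against `χ_{u′}`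
  rw [hPCT u' u f hf, hPCT u' σ f hf] at hsum
  -- `⟨χ_σ, χ_{u′}⟩_e = conj ⟨χ_{u′}, χ_σ⟩_e = conj (−1) = −1`
  have hσu' : 𝔇.innerG (𝔇.char σ) (𝔇.char u') = -1 := by
    rw [F0P3cStCharTSScFin.innerG_conj_symm 𝔇 (𝔇.char u') (𝔇.char σ), h61c u' σ hu'σ hpair', map_neg, map_one]
  -- hence `⟨χ_u, χ_{u′}⟩_e = 1`
  have huu' : 𝔇.innerG (𝔇.char u) (𝔇.char u') = 1 := by
    rw [hσu'] at hsum
    linear_combination hsum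
  -- if `u ≠ u′`: Prop. 12.6.1 (b) makes `{u, u′}` a pair of the three kinds, (c) gives `−1 = 1`
  by_contra hne
  have hk : 𝔇.IsEllipticPair u u' := h61b u u' hu hu' (by rw [huu']; exact one_ne_zero) hne
  have h1 := h61c u u' hne hk
  rw [huu'] at h1
  norm_num at h1

end Generic

/-! ## §2 The organ instance on `U(Φ₃)(L⁺_v)`: (MATE-UNIQ) from the package's other conjuncts -/

section Organ

/-- **(MATE-UNIQ) ★-DERIVED on the quasi-split model `Gqs L v = U(Φ₃)(L⁺_v)` (`v` non-split).**  For a §12.5 datum `𝔇` on the organ's frame (COMPAT `𝔇.μG = νQv`,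
`𝔇.orb = mQv` canonical, `regG ↔ IsRegularElt`) satisfying ★ `PseudoCoeffExists`, ★ `PseudoCoeffTrace`, Prop. 12.6.1 (b)(c), (C2) `EllCartanAE`, (SPLIT-NOT-ELL), and the
PAIR sockets (PS2) and (NONL2-PAR) of the (S-𝔇) package (VERBATIM, with its parameter map `par`): a square-integrable `σ` has at most one non-square-integrable partner `u`
with `{u, σ}` of the three kinds.  Proof: §1 with `f` a pseudo-coefficient of `u′` (exists: `u′` is elliptic), the vanishing `Tr i_G(par u)(f) = 0` being ★ «PSE★» ED. 2
`psTrace_pseudoCoeff_eq_zero_of_isPseudoCoeff` and `Tr u(f) + Tr σ(f) = Tr i_G(par u)(f)` being (PS2).  The conclusion is the (MATE-UNIQ) conjunct of `stub_EllipticPackage`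
token for token. [cite: Rogawski1990, §12.2 pp. 173–174; §12.6 p. 187, Prop. 12.6.1 (b)(c) p. 188; §12.7 Lemma 12.7.2 (proof) p. 192] -/
theorem mateUniq_of_carpet
    (L : Type) [Field L] [NumberField L] [IsCMField L] (v : HeightOneSpectrum (𝓞 ↥(maximalRealSubfield L)))
    (hns : ∀ w : PlacesOver L v, IsCMField.complexConj L • w.1 = w.1)
    [MeasurableSpace ((UnitaryGroup.cmDatum L 2 (Matrix.of fun i j : Fin 2 => if i.val + j.val + 1 = 2 then (1 : L) else 0)).Local v × (UnitaryGroup.cmDatum L 1 (Matrix.of fun i j : Fin 1 => if i.val + j.val + 1 = 1 then (1 : L) else 0)).Local v)]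
    [MeasurableSpace (Gqs L v)] [BorelSpace (Gqs L v)]
    [∀ γ : Gqs L v, MeasurableSpace (Gqs L v ⧸ Subgroup.centralizer ({γ} : Set (Gqs L v)))]
    [∀ γ : Gqs L v, BorelSpace (Gqs L v ⧸ Subgroup.centralizer ({γ} : Set (Gqs L v)))]
    [MeasurableSpace (Gqs L v ⧸ Subgroup.center (Gqs L v))]
    (νQv : Measure (Gqs L v)) [νQv.IsHaarMeasure] [νQv.IsMulRightInvariant]
    (mQv : OrbitalMeasureFamily (Gqs L v))
    (hcanQ : mQv.IsCanonical (fun γ => IsRegularElt (γ.val : GL (Fin 3) (UnitaryGroup.LocalRing L v))) νQv)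
    (𝔇 : Ch12Sec5.EllipticData (Gqs L v) ((UnitaryGroup.cmDatum L 2 (Matrix.of fun i j : Fin 2 => if i.val + j.val + 1 = 2 then (1 : L) else 0)).Local v × (UnitaryGroup.cmDatum L 1 (Matrix.of fun i j : Fin 1 => if i.val + j.val + 1 = 1 then (1 : L) else 0)).Local v))
    -- ══ COMPAT (three of the seven clauses of the (S-𝔇) package) ══
    (hμG : 𝔇.μG = νQv) (horb : 𝔇.orb = mQv)
    (hreg : ∀ γ : Gqs L v, γ ∈ 𝔇.regG ↔ IsRegularElt (γ.val : GL (Fin 3) (UnitaryGroup.LocalRing L v)))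
    -- ══ CARPET relations at `𝔇` ══
    (hPCE : Ch12Sec6.PseudoCoeffExists 𝔇) (hPCT : Ch12Sec6.PseudoCoeffTrace 𝔇)
    (h61b : Ch12Sec6.Prop1261b 𝔇) (h61c : Ch12Sec6.Prop1261c 𝔇)
    -- ══ (C2) and (SPLIT-NOT-ELL) ══
    (hTell : 𝔇.EllCartanAE)
    (hsplit : ∀ t : ↥(cmBorelTriple L 3 v).M,
      IsRegularElt ((((t : ↥(unitaryGroupOfForm (conjLocal L (IsCMField.complexConj L) v) (cmLocalForm L 3 v))) : Gqs L v).val :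
        GL (Fin 3) (UnitaryGroup.LocalRing L v))) →
      ((t : ↥(unitaryGroupOfForm (conjLocal L (IsCMField.complexConj L) v) (cmLocalForm L 3 v))) : Gqs L v) ∉ 𝔇.ellG)
    -- ══ the PAIR sockets (PS2) and (NONL2-PAR) of the package, VERBATIM ══
    (par : IrrClass (Gqs L v) → (((UnitaryGroup.LocalRing L v)ˣ →* ℂˣ) × (↥(normOneUnits (conjLocal L (IsCMField.complexConj L) v)) →* ℂˣ)))
    (hPS2 : ∀ π σ : IrrClass (Gqs L v), ¬ 𝔇.IsL2 π → 𝔇.IsL2 σ → 𝔇.IsEllipticPair π σ → ∀ f : Gqs L v → ℂ, IsLocSmooth f →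
        π.smoothTrace νQv f + σ.smoothTrace νQv f = Representation.smoothTrace (G := Gqs L v) (UnitaryGroup.cmPrincipalSeries L 3 v (UnitaryGroup.cmTorusCharPair L v (par π).1 (par π).2)) νQv f)
    (hNP : ∀ π : IrrClass (Gqs L v), ¬ 𝔇.IsL2 π →
        π.IsConstituentOf (UnitaryGroup.cmPrincipalSeries L 3 v (UnitaryGroup.cmTorusCharPair L v (par π).1 (par π).2)) ∧
          Continuous (par π).1 ∧ Continuous (par π).2) :
    ∀ σ u u' : IrrClass (Gqs L v), 𝔇.IsL2 σ → ¬ 𝔇.IsL2 u → ¬ 𝔇.IsL2 u' → 𝔇.IsEllipticPair u σ → 𝔇.IsEllipticPair u' σ → u = u' := by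
  intro σ u u' hσ hu hu' hpair hpair'
  have huσ : u ≠ σ := fun h => hu (by rw [h]; exact hσ)
  have hu'σ : u' ≠ σ := fun h => hu' (by rw [h]; exact hσ)
  -- a pseudo-coefficient of the elliptic class `u′`
  obtain ⟨hell', -⟩ := F0P3cStCharTSSocketsOut.isEllipticRep_of_isEllipticPair 𝔇 h61c hTell hu'σ hpair'
  obtain ⟨f, hf⟩ := hPCE u' hell'
  have hfs : IsLocSmooth f := ⟨hf.1.1, hf.1.2⟩
  -- (PS2) at `(u, σ)` and ★ «PSE★»: `Tr u(f) + Tr σ(f) = Tr i_G(par u)(f) = 0`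
  obtain ⟨-, hc1, hc2⟩ := hNP u hu
  have hsum := hPS2 u σ hu hσ hpair f hfs
  rw [F0P3cStCharTSPsePseudo.psTrace_pseudoCoeff_eq_zero_of_isPseudoCoeff L v hns νQv mQv hcanQ 𝔇 horb hreg hsplit u' f hf (par u) hc1 hc2,
    ← hμG] at hsum
  exact eq_of_mates_of_trace_add_eq_zero 𝔇 hPCT h61b h61c hTell huσ hu'σ hpair hpair' hf hsum

end Organ

end Summit.HodgeConjecture.HodgeConjecture.Cruxes.H413.F0P3cStCharTSMateUniqOut

end
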